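import Mathlib
import Summits.Langlands.Langlands.Theses.PhantomRMYoshida
import Summits.Langlands.Langlands.Theorems.PhantomRMYoshidaStableYoshidaCongruenceSector
import Summits.Langlands.Langlands.Theorems.PhantomRMYoshidaStableYoshidaCongruenceLocalConditionsTransfer
import Summits.Langlands.Langlands.Theorems.PhantomRMYoshidaStableYoshidaCongruenceResidualLattice
import Summits.Langlands.Langlands.Theorems.PhantomRMYoshidaStableYoshidaCongruenceOrdinaryFrameFp
import Summits.Langlands.Langlands.Theorems.PhantomRMYoshidaStableYoshidaCongruenceBlockModelFp
import Summits.Langlands.Langlands.Theorems.PhantomRMYoshidaFaltingsTateModuleQGate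
import Literature.NumberTheory.GaloisRepresentations.SerreWeight
import Literature.NumberTheory.GaloisRepresentations.ResidualPair
import Literature.NumberTheory.GaloisRepresentations.ResidualPairIntegrality
import Literature.AlgebraicGeometry.Motives.FaltingsAbelian
import Literature.AlgebraicGeometry.Motives.FaltingsFinitenessI
import HarnessLib

/-!
# Route `PhantomRMYoshida`, crux `StableYoshidaCongruence` (stmt-Langlands-13640), line
# `bilevel-one-five-anchor`: the bilevel-`5` SECTOR THEOREM modulo the lever (Stub 5 `stub_bl5SectorModuloLever`)

The `p = 5` twin of the landed Burkhardt–Weddle sector theorem `stub_bwSectorModuloFacts` (p117182): granted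
three published facts — Faltings through the route's named-fact gate `FaltingsFinitenessI` (stmt-Langlands-15084;
Satz 3/4 over `ℚ` are derived IN the proof by `faltings_tate_bijective_of_finitenessI` /
`isSemisimpleRepresentation_rationalTateRep_of_finitenessI`, `Theorems/PhantomRMYoshidaFaltingsTateModuleQGate.lean`),
the Serre–Tate ordinary filtration `ordinaryReduction_tateModule_filtration` and the Weil pairing
`weilPairing_rationalTateModule` — and granted THE LEVER of the line (the statement of the registered stub
`stub_bilevelFiveSwitch`, inlined verbatim as a hypothesis: at `p = 5`, a block-diagonal pair `ρb = τ ⊕ τ'` of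
irreducible `GL₂(𝔽₅)`-representations with `det = ε̄⁻¹`, ordinary-flat at `5` and unramified at `2`, `3`, is
congruent to `H¹` of a MODULAR abelian surface `B/ℚ` with good ordinary reduction at `5` and `End_ℚ(B) = ℤ`;
OPEN on paper at its step K1b — descent of Mukai's rationality of the weak-bilevel-`5` moduli threefold to the
twist — and therefore NOT a Literature fact), the crux `StableYoshidaCongruence` holds at every datum
`(p, k, red, σ, σ')` of the BILEVEL-`5` SECTOR: `p = 5`, each of `σ`, `σ'` is `𝔽₅`-rational, both are peu
ramifiées at `5`, and both are unramified at `2` and at `3` (sector predicate inlined, no new definition).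

Proof (all pieces landed): `stub_blockModelFp` (p128445) descends the pair to `ρb = τ ⊕ τ'` over `𝔽₅`
(`IsBlockPair`, `IsModelOf`, irreducible constituents, `DetCondFp`); the BW transfer lemmas
`isPeuRamifie_toLocal_of_isModelOf`, `isUnramifiedAt_of_isModelOf` and the residual-lattice stubs
`stub_residualLattice` + `stub_ordinaryFrameFp` (fed by the crux's own `Sh`-witness H5) give `IsOrdinaryFlatAt 5 v ρb`
and unramifiedness at `2`, `3`; the lever gives `B`; the framed `ρ₀ := framedH1 5 B b` is irreducible
(`stub_tateModuleIrreducible`), symplectic-`ε⁻¹` (`isSymplectic_framedH1`), Greenberg `(0,0,1,1)`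
(`stub_tateModuleGreenberg`), has residual pair `(σ, σ')` (`hasResidualPair_of_congruence`, the LTWS lemma made
generic in `p`, proved here), is residually `5`-distinguished (`stub_charpolyCongruence` +
`stub_distinguishedTransferLocal`) and automorphic (the lever's last clause).  This is the registered reshape stub
`stub_bl5SectorModuloLever` of the lead-a2 skeleton `Cruxes/StableYoshidaCongruence/Lines/bilevel_one_five_anchor.lean`
(child A₅ of the planners' sector split; route-choice RCHOICE-7 interface).  Lead prover-line-stmt-Langlands-13640-a2-0,
2026-08-16.
-/

set_option linter.dupNamespace false

noncomputable section

open CategoryTheory IsDedekindDomain Polynomial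
open scoped NumberField
open Literature.NumberTheory.GaloisRepresentations Literature.NumberTheory.Automorphic
open Literature.AlgebraicGeometry.Motives (AbelianVariety)
open Literature.NumberTheory.DiophantineGeometry (weilPairing_rationalTateModule
  ordinaryReduction_tateModule_filtration)
open Summit.Langlands.Langlands.Theses.PhantomRMYoshida
open Summit.Langlands.Langlands.Theorems.PhantomRMYoshida (faltings_tate_bijective_of_finitenessI
  isSemisimpleRepresentation_rationalTateRep_of_finitenessI)
open Summit.Langlands.Langlands.Cruxes.StableYoshidaCongruence.LevelThreeWeierstrassSwitch
open Summit.Langlands.Langlands.Cruxes.StableYoshidaCongruence.BurkhardtWeddleTwoThreeAnchor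

namespace Summit.Langlands.Langlands.Cruxes.StableYoshidaCongruence.BilevelOneFiveAnchor

/-! ## Dictionary lemma (generic `p`): the residual pair of a congruent framed `H¹` -/

section Residual

variable {p : ℕ} [Fact p.Prime] {k : Type} [Field k] [CharP k p] [TopologicalSpace k] [DiscreteTopology k]

/-- **`(ρ̄_{B,p})^{ss} ≅ σ ⊕ σ'` for a congruent framed representation** (the landed LTWS lemma
`hasResidualPair_of_congruence`, made generic in `p`).  If every `det(X - r(g))` has a `ℤ_p`-lift reducing
mod `p` to `det(X - ρb(g))`, `ρb ⊗ k` is conjugate to `σ ⊕ σ'` (`IsModelOf`) and `r` is unramified almost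
everywhere, then `r.HasResidualPair red σ σ'`. -/
theorem hasResidualPair_of_congruence (red : Valued.integer (PadicAlgCl p) →+* k)
    {ρb : FramedGaloisRep ℚ (ZMod p) 4} {σ σ' : FramedGaloisRep ℚ k 2} (hmodel : IsModelOf ρb σ σ')
    {r : FramedGaloisRep ℚ (PadicAlgCl p) 4}
    (hcong : ∀ g : Field.absoluteGaloisGroup ℚ, ∃ P : Polynomial ℤ_[p],
        P.map (algebraMap ℤ_[p] (PadicAlgCl p)) = FramedRep.charpoly r g ∧
        P.map (PadicInt.toZMod (p := p)) = FramedRep.charpoly ρb g)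
    (hunr : ∀ᶠ v : HeightOneSpectrum (𝓞 ℚ) in Filter.cofinite, r.IsUnramifiedAt v) :
    r.HasResidualPair red σ σ' := by
  have hfin : {v : HeightOneSpectrum (𝓞 ℚ) | ¬ (r.IsUnramifiedAt v ∧ ρb.IsUnramifiedAt v)}.Finite :=
    Filter.eventually_cofinite.1 (hunr.and (eventually_isUnramifiedAt_zmod ρb))
  refine FramedGaloisRep.hasResidualPair_of_frobenius hfin fun v hv => ?_
  simp only [Set.mem_setOf_eq, not_not] at hv
  obtain ⟨hrv, hρbv⟩ := hv
  obtain ⟨hσv, hσ'v⟩ := hmodel.isUnramifiedAt hρbv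
  obtain ⟨𝔓, h𝔓⟩ := v.primesAbove_nonempty
  obtain ⟨g, hg⟩ := HeightOneSpectrum.exists_isArithFrobAt_of_mem_primesAbove_holds h𝔓
  obtain ⟨P, hP, hPred⟩ := hcong g
  obtain ⟨P', hP'1, hP'2⟩ := exists_integer_polynomial_of_padicInt red P
  refine ⟨hrv, hσv, hσ'v, 𝔓, h𝔓, g, hg, P', ?_, ?_⟩
  · rw [hP'1, hP]
  · rw [hP'2, hPred, hmodel.charpoly_map]

end Residual

/-! ## The sector theorem modulo the lever (registered Stub 5) -/

/-- **Stub 5 (`stub_bl5SectorModuloLever`, reshape of lead a2, cycle 1; provable now and proved below as glue —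
the `p = 5` twin of the landed `stub_bwSectorModuloFacts`, p117182).**  Granted three published facts — Faltings
through the route's named-fact gate `FaltingsFinitenessI` (stmt-Langlands-15084; Satz 3/4 over `ℚ` derived IN the
proof by `faltings_tate_bijective_of_finitenessI` / `isSemisimpleRepresentation_rationalTateRep_of_finitenessI`,
route-choice rewire RCHOICE-7 adopted), the Serre–Tate ordinary filtration and the Weil pairing — and granted THE
LEVER (the statement of Stub 2 `stub_bilevelFiveSwitch`, inlined verbatim as the fourth hypothesis: the bilevel-`5`
switch onto a modular abelian surface, OPEN at K1b), the crux holds at every datum of the bilevel-`5` sector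
(`BL5Sector`, inlined verbatim: `p = 5`, each constituent `𝔽₅`-rational, peu ramifié at `5`, unramified at `2`
and `3`).  Proof (sorry-free, all pieces landed): Stub 1 `stub_blockModelFp` (p128445) descends the pair to a
block-diagonal `GL₄(𝔽₅)`-model `ρb = τ ⊕ τ'`; the landed BW transfer stubs turn the crux's H5-witness into
`IsOrdinaryFlatAt 5 v ρb` (`isPeuRamifie_toLocal_of_isModelOf`, `stub_residualLattice`, `stub_ordinaryFrameFp`) and
pass unramifiedness at `2`, `3` to `ρb` (`isUnramifiedAt_of_isModelOf`); the lever produces the modular `B`; the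
framed `ρ₀ = H¹(B, ℚ̄₅)` (`framedH1`) is irreducible (`stub_tateModuleIrreducible`, Faltings + `End = ℤ`),
symplectic-`ε⁻¹` (`isSymplectic_framedH1`, Weil), Greenberg `(0,0,1,1)` at `5` (`stub_tateModuleGreenberg`,
Serre–Tate), has residual pair `(σ, σ')` (`hasResidualPair_of_congruence`), is residually `5`-distinguished
(`stub_charpolyCongruence` + `stub_distinguishedTransferLocal`, transferred from the H5-witness) and automorphic.
[cite: Faltings1983Endlichkeit, §5 Satz 3–4, §6 Satz 5–6; SerreTate1968GoodReduction, §1;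
Milne1986AbelianVarieties, §16; BoxerCalegariGeePilloni2025, Theorem 1 (p. 3), §1.8.10–1.8.12 (arXiv:2502.20645)] -/
theorem stub_bl5SectorModuloLever :
    FaltingsFinitenessI → ordinaryReduction_tateModule_filtration → weilPairing_rationalTateModule →
    (∀ (p : ℕ) [Fact p.Prime], p = 5 →
      ∀ (τ τ' : FramedGaloisRep ℚ (ZMod p) 2) (ρb : FramedGaloisRep ℚ (ZMod p) 4),
      IsBlockPair τ τ' ρb → τ.toGaloisRep.IsIrreducible → τ'.toGaloisRep.IsIrreducible →
      DetCondFp p τ τ' →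
      (∀ v : HeightOneSpectrum (𝓞 ℚ), ((p : ℕ) : 𝓞 ℚ) ∈ v.asIdeal → IsOrdinaryFlatAt p v ρb) →
      (∀ v : HeightOneSpectrum (𝓞 ℚ), ((2 : ℕ) : 𝓞 ℚ) ∈ v.asIdeal → ρb.IsUnramifiedAt v) →
      (∀ v : HeightOneSpectrum (𝓞 ℚ), ((3 : ℕ) : 𝓞 ℚ) ∈ v.asIdeal → ρb.IsUnramifiedAt v) →
      ∃ B : AbelianVariety ℚ,
        B.dim = 2 ∧
        (∀ v : HeightOneSpectrum (𝓞 ℚ), ((p : ℕ) : 𝓞 ℚ) ∈ v.asIdeal → B.HasGoodOrdinaryReductionAt v) ∧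
        EndTrivial B ∧
        ∀ (b : Module.Basis (Fin 4) ℚ_[p] (B.rationalTateModule p))
          (r : FramedGaloisRep ℚ (PadicAlgCl p) 4),
          TateFrame p B b r →
          (∀ g : Field.absoluteGaloisGroup ℚ, ∃ P : Polynomial ℤ_[p],
              P.map (algebraMap ℤ_[p] (PadicAlgCl p)) = FramedRep.charpoly r g ∧
              P.map (PadicInt.toZMod (p := p)) = FramedRep.charpoly ρb g) ∧
          ∀ (hcpt : isCompact_glFiniteIntegralLevel 4 ℚ) (ι : PadicAlgCl p ≃+* ℂ),
            ∃ π : CuspidalAutomorphicRepData 4 ℚ hcpt, π.1.IsLAlgebraic ∧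
              ∀ᶠ v : HeightOneSpectrum (𝓞 ℚ) in Filter.cofinite,
                ∃ a : Multiset ℂ, π.1.HasSatakeParamAt v a ∧ r.IsUnramifiedAt v ∧
                  r.HasFrobCharpolyAt v (arithFrobPolyOfSatake ι v.residueCard 1 a)) →
    ∀ (p : ℕ) [Fact p.Prime], p ≠ 2 → ∀ (k : Type) [Field k] [CharP k p] [IsAlgClosed k]
      [TopologicalSpace k] [DiscreteTopology k] (red : Valued.integer (PadicAlgCl p) →+* k)
      (σ σ' : FramedGaloisRep ℚ k 2),
      (p = 5 ∧
        (∀ g : Field.absoluteGaloisGroup ℚ, ∃ Q₁ Q₂ : Polynomial (ZMod p),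
          Q₁.map (ZMod.castHom (dvd_refl p) k) = FramedRep.charpoly σ g ∧
          Q₂.map (ZMod.castHom (dvd_refl p) k) = FramedRep.charpoly σ' g) ∧
        (∀ v : HeightOneSpectrum (𝓞 ℚ), ((p : ℕ) : 𝓞 ℚ) ∈ v.asIdeal →
          ModPGaloisRep.IsPeuRamifie (σ.toLocal v) ∧ ModPGaloisRep.IsPeuRamifie (σ'.toLocal v)) ∧
        (∀ v : HeightOneSpectrum (𝓞 ℚ), ((2 : ℕ) : 𝓞 ℚ) ∈ v.asIdeal →
          σ.IsUnramifiedAt v ∧ σ'.IsUnramifiedAt v) ∧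
        (∀ v : HeightOneSpectrum (𝓞 ℚ), ((3 : ℕ) : 𝓞 ℚ) ∈ v.asIdeal →
          σ.IsUnramifiedAt v ∧ σ'.IsUnramifiedAt v)) →
      CruxAt p k red σ σ' := by
  intro hFI hST hWeil hLever p _ hp k _ _ _ _ _ red σ σ' hsec hA hA' hirr hirr' hdet hnc hw hcpt ι
  obtain ⟨hp5, hrat, hpeu, htwo, hthree⟩ := hsec
  obtain ⟨ρw, hSw⟩ := hw
  -- Faltings Satz 3/4 over ℚ from Finiteness I (in-tree, FaltingsTateModuleQGate)
  have hF : ∀ (q : ℕ) [Fact q.Prime] (B : AbelianVariety ℚ),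
      Literature.AlgebraicGeometry.Motives.faltings_tate_bijective B B q :=
    fun q _ B => faltings_tate_bijective_of_finitenessI hFI q B
  have hS : ∀ (q : ℕ) [Fact q.Prime] (B : AbelianVariety ℚ),
      Literature.AlgebraicGeometry.Motives.isSemisimpleRepresentation_rationalTateRep B q :=
    fun q _ B => isSemisimpleRepresentation_rationalTateRep_of_finitenessI hFI q B
  -- Stub 1 (landed): block-diagonal 𝔽_p-model
  obtain ⟨τ, τ', ρb, hblock, hmodel, hτ, hτ', hdetFp⟩ :=
    stub_blockModelFp p k σ σ' hirr hirr' hdet hrat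
  -- landed BW transfer stubs: the local conditions of the model
  have hord : ∀ v : HeightOneSpectrum (𝓞 ℚ), ((p : ℕ) : 𝓞 ℚ) ∈ v.asIdeal → IsOrdinaryFlatAt p v ρb := by
    intro v hv
    refine ⟨isPeuRamifie_toLocal_of_isModelOf hmodel (hpeu v hv).1 (hpeu v hv).2, ?_⟩
    obtain ⟨M, hM1, hM2, hM3, -⟩ :=
      stub_residualLattice p hp k red σ σ' ρw v hv (hSw.2.1 v hv).1 (hSw.2.1 v hv).2 hSw.2.2
    exact stub_ordinaryFrameFp p hp k σ σ' ρb M v hv hirr hirr' hdet hmodel hM1 hM2 hM3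
  have h2 : ∀ v : HeightOneSpectrum (𝓞 ℚ), ((2 : ℕ) : 𝓞 ℚ) ∈ v.asIdeal → ρb.IsUnramifiedAt v :=
    fun v hv => isUnramifiedAt_of_isModelOf hmodel (htwo v hv).1 (htwo v hv).2
  have h3 : ∀ v : HeightOneSpectrum (𝓞 ℚ), ((3 : ℕ) : 𝓞 ℚ) ∈ v.asIdeal → ρb.IsUnramifiedAt v :=
    fun v hv => isUnramifiedAt_of_isModelOf hmodel (hthree v hv).1 (hthree v hv).2
  -- the lever
  obtain ⟨B, hdim, hgood, hEnd, hH1⟩ := hLever p hp5 τ τ' ρb hblock hτ hτ' hdetFp hord h2 h3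
  -- the framed H¹ and the p-generic dictionary (landed)
  have hrank : Module.finrank ℚ_[p] (B.rationalTateModule p) = 4 := by
    rw [B.finrank_rationalTateModule_eq_holds p (natCast_prime_ne_zero_rat p), hdim]
  haveI : Module.Finite ℚ_[p] (B.rationalTateModule p) :=
    Module.finite_of_finrank_pos (by rw [hrank]; norm_num)
  let b : Module.Basis (Fin 4) ℚ_[p] (B.rationalTateModule p) :=
    Module.finBasisOfFinrankEq ℚ_[p] _ hrank
  obtain ⟨hcong, hAut⟩ := hH1 b (framedH1 p B b) (tateFrame_framedH1 p B b)
  obtain ⟨π, hπL, hπ⟩ := hAut hcpt ι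
  have hunr : ∀ᶠ v : HeightOneSpectrum (𝓞 ℚ) in Filter.cofinite, (framedH1 p B b).IsUnramifiedAt v :=
    hπ.mono fun v ⟨a, _, h, _⟩ => h
  have hpair : (framedH1 p B b).HasResidualPair red σ σ' :=
    hasResidualPair_of_congruence red hmodel hcong hunr
  have hirr₀ : (framedH1 p B b).toGaloisRep.IsIrreducible :=
    stub_tateModuleIrreducible hF hS p B b (framedH1 p B b) (tateFrame_framedH1 p B b) hEnd
  have hGr : ∀ v : HeightOneSpectrum (𝓞 ℚ), ((p : ℕ) : 𝓞 ℚ) ∈ v.asIdeal →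
      (framedH1 p B b).IsGreenbergOrdinaryOfShapeAt v ![0, 0, 1, 1] :=
    fun v hv => stub_tateModuleGreenberg hST p B b (framedH1 p B b) (tateFrame_framedH1 p B b) hdim v hv
      (hgood v hv)
  refine ⟨framedH1 p B b, hirr₀, ⟨isSymplectic_framedH1 p hWeil B b, fun v hv => ⟨hGr v hv, ?_⟩, hpair⟩,
    ⟨π, hπL, hπ⟩⟩
  exact stub_distinguishedTransferLocal p hp k red ρw (framedH1 p B b) v hv
    (stub_charpolyCongruence p k red σ σ' ρw (framedH1 p B b) hSw.2.2 hpair) (hSw.2.1 v hv).2 (hGr v hv)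

end Summit.Langlands.Langlands.Cruxes.StableYoshidaCongruence.BilevelOneFiveAnchor

end
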